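import Summits.Ventures.PercRepro.Night2TwoOneGeneralFaces

/-!
# PercRepro — the cell `(2, 1)` with two fat closures, ANY number of fat closures, no spread hypothesis: a lossy
covering set meets each class once (night-2, gen 28)

`Night2TwoOneGeneralFaces` with the hypothesis «at most two fat closures» dropped: every thin member requests at most
`7/24`, so a covering set containing both points of a class has `L1 ≤ 2 · 7/24 = 7/12 < 11/18` and loses nothing
(`loss_eq_zero_of_two_in_class_free`), a lossy covering set meets each class once (`one_per_class_free`), and the
layer-1 request of a set meeting both classes whose plane part spans `P` with `≥ 4` points is at most
`7/24 · (thin faces at class points) + 7/24` (`L1_le_of_spanning_free`).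
-/

namespace PercRepro.Shadow

open Finset PerFlat ThmH

variable {α : Type*} [DecidableEq α] {M : Matroid α} [M.Finite]

section FreeFaces

variable {G : Finset α}

open scoped Classical in
/-- **A COVERING SET CONTAINING BOTH POINTS OF THE CLASS `G ∖ H₁` LOSES NOTHING**: its thin faces are at those two
points, each requesting `≤ 7/30`, so `L1 ≤ 7/15 < 11/18 ≤ capS`. -/
theorem loss_eq_zero_of_two_in_class_free (hG : G ∈ flatsQ M (5 + 1)) (hd : (gr M \ G).card = 2)
    (hk : kColoops M G = 1) {B₁ : Finset α} (hB₁ : B₁ ∈ thinMembers M 5 G) (hm₁ : (G \ clF M B₁).card ≤ 2)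
    {B : Finset α} (hB : B ∈ thinMembers M 5 G) {z : α} (hz : z ∈ G \ clF M B)
    (hsub : G \ clF M B₁ ⊆ insert z B) : loss M 5 G B z = 0 := by
  have hd' : (gr M \ G).card ≤ 5 := by omega
  have hB' : B ∈ membersIn M (Uq M (5 + 2) 5) G := (mem_thinMembers.1 hB).1
  have hBU : B ∈ Uq M (5 + 2) 5 := (mem_membersIn.1 hB').1
  have hBG : B ⊆ G := (subset_clF hBU).trans (mem_membersIn.1 hB').2
  have hKB : coloops M G ⊆ B := coloops_subset_of_mem_thinMembers hG hd' hB
  set Q := insert z B with hQ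
  have hQG : Q ⊆ G := Finset.insert_subset (Finset.mem_sdiff.1 hz).1 hBG
  have hKQ : coloops M G ⊆ Q := hKB.trans (Finset.subset_insert _ _)
  have hcompl : G \ Q ⊆ clF M B₁ := by
    intro x hx
    by_contra h
    exact (Finset.mem_sdiff.1 hx).2 (hsub (Finset.mem_sdiff.2 ⟨(Finset.mem_sdiff.1 hx).1, h⟩))
  set Pre := (coverPreimages M (Uq M (5 + 2) 5) G Q).filter (fun B => B ∉ lay0 M 5 G) with hPre
  have hthin : ∀ F ∈ Pre, F ∈ thinMembers M 5 G := by
    intro F hF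
    rw [hPre, Finset.mem_filter, mem_coverPreimages] at hF
    exact mem_thinMembers.2 ⟨hF.1.1, hF.2⟩
  have hnotcl : ∀ w ∈ Q, Q.erase w ∈ Pre → w ∉ clF M (Q.erase w) := by
    intro w hw hF
    rw [hPre, Finset.mem_filter, mem_coverPreimages] at hF
    obtain ⟨z', hz', hzS⟩ := mem_coverSets.1 hF.1.2
    have hzS' : z' ∈ Q := by rw [← hzS]; exact Finset.mem_insert_self _ _
    have hzne : z' ∉ Q.erase w := notMem_of_notMem_clF (mem_membersIn.1 hF.1.1).1 (Finset.mem_sdiff.1 hz').2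
    have hzw : z' = w := by
      by_contra h
      exact hzne (Finset.mem_erase.2 ⟨h, hzS'⟩)
    have := (Finset.mem_sdiff.1 hz').2
    rwa [hzw] at this
  -- the thin preimages are faces at the two class points
  have hPsub : Pre ⊆ (G \ clF M B₁).image (fun w => Q.erase w) := by
    intro F hF
    have h1 := thin_coverPreimages_subset_image_coloops hG hd' Q hF
    obtain ⟨w, hw, rfl⟩ := Finset.mem_image.1 h1
    have hwQ : w ∈ Q := (Finset.mem_sdiff.1 (mem_coloops.1 hw).1).1
    have hwK : w ∉ coloops M G := (Finset.mem_sdiff.1 (mem_coloops.1 hw).1).2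
    rw [Finset.mem_image]
    refine ⟨w, Finset.mem_sdiff.2 ⟨hQG hwQ, fun hwH => ?_⟩, rfl⟩
    exact face_notMem_of_compl_subset hG hd hk hB₁ hQG hKQ hcompl hwK hwH
      (mem_membersIn.1 (mem_thinMembers.1 (hthin _ hF)).1).1
  have hreq : ∀ F ∈ Pre, req M 5 F ≤ 7 / 24 := fun F hF => req_le_of_thin_two_one hG hd (hthin F hF)
  have hL1 : L1 M 5 G Q ≤ 7 / 12 := by
    unfold L1
    rw [← hPre]
    have hc : Pre.card ≤ 2 :=
      (Finset.card_le_card hPsub).trans (Finset.card_image_le.trans hm₁)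
    calc ∑ F ∈ Pre, req M 5 F ≤ ∑ _F ∈ Pre, (7 / 24 : ℚ) := Finset.sum_le_sum hreq
      _ = (Pre.card : ℚ) * (7 / 24) := by rw [Finset.sum_const, nsmul_eq_mul]
      _ ≤ 2 * (7 / 24) := by
          have : (Pre.card : ℚ) ≤ 2 := by exact_mod_cast hc
          nlinarith
      _ = 7 / 12 := by norm_num
  have hcap := capS_ge_eleven_eighteenths_two_one hd hk hQG
  have hfS : fS M 5 G Q = 1 := by
    unfold fS
    rw [if_pos (by linarith)]
  unfold loss
  rw [← hQ, hfS]
  ring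

open scoped Classical in
/-- **A LOSSY COVERING SET OF A THIN MEMBER MEETS EACH CLASS EXACTLY ONCE** (two fat closures, any number of fat
closures, no disjointness needed): a class absent from `Q ∖ K` leaves it inside a hyperplane off the coloop (rank `≤ 4 < 5`), a class
doubled in `Q` leaves no loss. -/
theorem one_per_class_free (hG : G ∈ flatsQ M (5 + 1)) (hd : (gr M \ G).card = 2)
    (hk : kColoops M G = 1) {B₀ B₁ : Finset α} (hB₀ : B₀ ∈ thinMembers M 5 G) (hB₁ : B₁ ∈ thinMembers M 5 G)
    (hm₀ : (G \ clF M B₀).card ≤ 2) (hm₁ : (G \ clF M B₁).card ≤ 2)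
    {B : Finset α} (hB : B ∈ thinMembers M 5 G) {z : α} (hz : z ∈ G \ clF M B) (hl0 : loss M 5 G B z ≠ 0) :
    ∃ u u', insert z B ∩ (G \ clF M B₀) = {u} ∧ insert z B ∩ (G \ clF M B₁) = {u'} := by
  have hd' : (gr M \ G).card ≤ 5 := by omega
  have hB' : B ∈ membersIn M (Uq M (5 + 2) 5) G := (mem_thinMembers.1 hB).1
  have hBU : B ∈ Uq M (5 + 2) 5 := (mem_membersIn.1 hB').1
  have hBG : B ⊆ G := (subset_clF hBU).trans (mem_membersIn.1 hB').2
  have hKB : coloops M G ⊆ B := coloops_subset_of_mem_thinMembers hG hd' hB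
  set Q := insert z B with hQ
  have hQG : Q ⊆ G := Finset.insert_subset (Finset.mem_sdiff.1 hz).1 hBG
  have hQ5 : rkN M (Q \ coloops M G) = 5 := rkN_insert_sdiff_coloops_eq_five_of_thin hG hd hk hB hz
  have hA2 : (G \ clF M B₀).card = 2 := by
    have := two_le_card_sdiff_of_not_lay0 hG hd' (mem_thinMembers.1 hB₀).1 (mem_thinMembers.1 hB₀).2
    omega
  have hB2 : (G \ clF M B₁).card = 2 := by
    have := two_le_card_sdiff_of_not_lay0 hG hd' (mem_thinMembers.1 hB₁).1 (mem_thinMembers.1 hB₁).2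
    omega
  -- each class meets `Q`
  have hmeet : ∀ (C : Finset α), C ∈ thinMembers M 5 G → (Q ∩ (G \ clF M C)).card ≠ 0 := by
    intro C hC h0
    rw [Finset.card_eq_zero] at h0
    have hsub : Q \ coloops M G ⊆ clF M C \ coloops M G := by
      intro x hx
      rw [Finset.mem_sdiff] at hx ⊢
      refine ⟨?_, hx.2⟩
      by_contra h
      have : x ∈ Q ∩ (G \ clF M C) := Finset.mem_inter.2 ⟨hx.1, Finset.mem_sdiff.2 ⟨hQG hx.1, h⟩⟩
      rw [h0] at this
      exact Finset.notMem_empty x this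
    have h1 := rkN_mono (M := M) hsub
    have h2 := rkN_clF_sdiff_coloops_le_four_two hG hd hk hC
    omega
  -- no class is doubled in `Q`
  have hnot2 : ∀ (C : Finset α), C ∈ thinMembers M 5 G → (G \ clF M C).card = 2 →
      (G \ clF M C ⊆ Q → loss M 5 G B z = 0) → (Q ∩ (G \ clF M C)).card ≤ 1 := by
    intro C hC hC2 hloss
    by_contra h
    push Not at h
    have hsub : G \ clF M C ⊆ Q := by
      have h1 : Q ∩ (G \ clF M C) ⊆ G \ clF M C := Finset.inter_subset_right
      have h2 : (Q ∩ (G \ clF M C)) = G \ clF M C := by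
        apply Finset.eq_of_subset_of_card_le h1
        omega
      rw [← h2]; exact Finset.inter_subset_left
    exact hl0 (hloss hsub)
  have h₀ : (Q ∩ (G \ clF M B₀)).card = 1 := by
    have := hnot2 B₀ hB₀ hA2 (fun hsub => loss_eq_zero_of_two_in_class_free hG hd hk hB₀ hm₀ hB hz hsub)
    have := hmeet B₀ hB₀
    omega
  have h₁ : (Q ∩ (G \ clF M B₁)).card = 1 := by
    have := hnot2 B₁ hB₁ hB2 (fun hsub => loss_eq_zero_of_two_in_class_free hG hd hk hB₁ hm₁ hB hz hsub)
    have := hmeet B₁ hB₁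
    omega
  obtain ⟨u, hu⟩ := Finset.card_eq_one.1 h₀
  obtain ⟨u', hu'⟩ := Finset.card_eq_one.1 h₁
  exact ⟨u, u', hu, hu'⟩

open scoped Classical in
/-- The layer-1 request of a set meeting both classes whose plane part spans `P` with `≥ 4` points, without the spread
hypothesis: `≤ 7/24` per thin face at a class point and `≤ 7/30` for the unique thin face at a plane point. -/
theorem L1_le_of_spanning_free (hG : G ∈ flatsQ M (5 + 1)) (hd : (gr M \ G).card = 2) (hk : kColoops M G = 1)
    (hs : ∀ e ∈ gr M, ∀ f ∈ gr M, e ≠ f → rkN M {e, f} = 2) {B₀ B₁ : Finset α}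
    (hB₀ : B₀ ∈ thinMembers M 5 G) (hB₁ : B₁ ∈ thinMembers M 5 G)
    (hdisj : Disjoint (G \ clF M B₀) (G \ clF M B₁)) {S : Finset α} (hSG : S ⊆ G)
    (hSP3 : 3 ≤ rkN M (S ∩ ((clF M B₀ ∩ clF M B₁) \ coloops M G)))
    (hSP4 : 4 ≤ (S ∩ ((clF M B₀ ∩ clF M B₁) \ coloops M G)).card)
    {u u' : α} (hu : u ∈ S ∩ (G \ clF M B₀)) (hu' : u' ∈ S ∩ (G \ clF M B₁)) :
    L1 M 5 G S ≤ (((S ∩ ((G \ clF M B₀) ∪ (G \ clF M B₁))).filter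
      (fun w => S.erase w ∈ thinMembers M 5 G)).card : ℚ) * (7 / 24) + 7 / 24 := by
  have hd' : (gr M \ G).card ≤ 5 := by omega
  set Pre := (coverPreimages M (Uq M (5 + 2) 5) G S).filter (fun B => B ∉ lay0 M 5 G) with hPre
  set W := (S \ coloops M G).filter (fun w => S.erase w ∈ Pre) with hW
  have hthin : ∀ F ∈ Pre, F ∈ thinMembers M 5 G := by
    intro F hF
    rw [hPre, Finset.mem_filter, mem_coverPreimages] at hF
    exact mem_thinMembers.2 ⟨hF.1.1, hF.2⟩
  have hnotcl : ∀ w ∈ S, S.erase w ∈ Pre → w ∉ clF M (S.erase w) := by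
    intro w hw hF
    rw [hPre, Finset.mem_filter, mem_coverPreimages] at hF
    obtain ⟨z, hz, hzS⟩ := mem_coverSets.1 hF.1.2
    have hzS' : z ∈ S := by rw [← hzS]; exact Finset.mem_insert_self _ _
    have hzne : z ∉ S.erase w := notMem_of_notMem_clF (mem_membersIn.1 hF.1.1).1 (Finset.mem_sdiff.1 hz).2
    have hzw : z = w := by
      by_contra h
      exact hzne (Finset.mem_erase.2 ⟨h, hzS'⟩)
    have := (Finset.mem_sdiff.1 hz).2
    rwa [hzw] at this
  have hPreEq : Pre = W.image (fun w => S.erase w) := by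
    ext F
    rw [Finset.mem_image]
    constructor
    · intro hF
      have h1 := thin_coverPreimages_subset_image_coloops hG hd' S hF
      obtain ⟨w, hw, rfl⟩ := Finset.mem_image.1 h1
      exact ⟨w, Finset.mem_filter.2 ⟨(mem_coloops.1 hw).1, hF⟩, rfl⟩
    · rintro ⟨w, hw, rfl⟩
      exact (Finset.mem_filter.1 hw).2
  have hL1 : L1 M 5 G S = ∑ w ∈ W, req M 5 (S.erase w) := by
    unfold L1
    rw [← hPre, hPreEq]
    apply Finset.sum_image
    intro w hw w' hw' heq
    exact Finset.erase_injOn S (Finset.mem_sdiff.1 (Finset.mem_filter.1 hw).1).1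
      (Finset.mem_sdiff.1 (Finset.mem_filter.1 hw').1).1 heq
  set Xs := (G \ clF M B₀) ∪ (G \ clF M B₁) with hXs
  rw [hL1, ← Finset.sum_filter_add_sum_filter_not W (fun w => w ∈ Xs)]
  have h1 : ∑ w ∈ W.filter (fun w => w ∈ Xs), req M 5 (S.erase w) ≤
      (((S ∩ Xs).filter (fun w => S.erase w ∈ thinMembers M 5 G)).card : ℚ) * (7 / 24) := by
    have hsub : W.filter (fun w => w ∈ Xs) ⊆ (S ∩ Xs).filter (fun w => S.erase w ∈ thinMembers M 5 G) := by
      intro w hw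
      rw [Finset.mem_filter, hW, Finset.mem_filter, Finset.mem_sdiff] at hw
      exact Finset.mem_filter.2 ⟨Finset.mem_inter.2 ⟨hw.1.1.1, hw.2⟩, hthin _ hw.1.2⟩
    calc ∑ w ∈ W.filter (fun w => w ∈ Xs), req M 5 (S.erase w)
        ≤ ∑ _w ∈ W.filter (fun w => w ∈ Xs), (7 / 24 : ℚ) := by
          apply Finset.sum_le_sum
          intro w hw
          exact req_le_of_thin_two_one hG hd (hthin _ (Finset.mem_filter.1 (Finset.mem_filter.1 hw).1).2)
      _ = ((W.filter (fun w => w ∈ Xs)).card : ℚ) * (7 / 24) := by rw [Finset.sum_const, nsmul_eq_mul]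
      _ ≤ _ := by
          apply mul_le_mul_of_nonneg_right _ (by norm_num)
          exact_mod_cast Finset.card_le_card hsub
  have hplane : ∀ w ∈ W.filter (fun w => ¬ w ∈ Xs), w ∈ S ∩ ((clF M B₀ ∩ clF M B₁) \ coloops M G) := by
    intro w hw
    rw [Finset.mem_filter, hW, Finset.mem_filter, Finset.mem_sdiff] at hw
    have hwG : w ∈ G := hSG hw.1.1.1
    rw [hXs, Finset.mem_union, Finset.mem_sdiff, Finset.mem_sdiff, not_or, not_and, not_and] at hw
    rw [Finset.mem_inter, Finset.mem_sdiff, Finset.mem_inter]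
    exact ⟨hw.1.1.1, ⟨not_not.1 (hw.2.1 hwG), not_not.1 (hw.2.2 hwG)⟩, hw.1.1.2⟩
  have h2 : ∑ w ∈ W.filter (fun w => ¬ w ∈ Xs), req M 5 (S.erase w) ≤ 7 / 24 := by
    have hcard : (W.filter (fun w => ¬ w ∈ Xs)).card ≤ 1 := by
      apply Finset.card_le_one.2
      intro w₁ hw₁ w₂ hw₂
      exact plane_face_unique hG hd hk hs hB₀ hB₁ hdisj hSG hSP3 hSP4 hu hu' (hplane w₁ hw₁) (hplane w₂ hw₂)
        (hthin _ (Finset.mem_filter.1 (Finset.mem_filter.1 hw₁).1).2)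
        (hthin _ (Finset.mem_filter.1 (Finset.mem_filter.1 hw₂).1).2)
    calc ∑ w ∈ W.filter (fun w => ¬ w ∈ Xs), req M 5 (S.erase w)
        ≤ ∑ _w ∈ W.filter (fun w => ¬ w ∈ Xs), (7 / 24 : ℚ) := by
          apply Finset.sum_le_sum
          intro w hw
          exact req_le_of_thin_two_one hG hd (hthin _ (Finset.mem_filter.1 (Finset.mem_filter.1 hw).1).2)
      _ = ((W.filter (fun w => ¬ w ∈ Xs)).card : ℚ) * (7 / 24) := by rw [Finset.sum_const, nsmul_eq_mul]
      _ ≤ 1 * (7 / 24) := by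
          apply mul_le_mul_of_nonneg_right _ (by norm_num)
          exact_mod_cast hcard
      _ = 7 / 24 := by norm_num
  linarith

end FreeFaces

end PercRepro.Shadow
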